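import Mathlib.RingTheory.Finiteness.Basic
import Mathlib.RingTheory.Finiteness.Nakayama
import Mathlib.LinearAlgebra.Quotient.Basic
import Mathlib.LinearAlgebra.Matrix.Charpoly.LinearMap
import Mathlib.Algebra.Polynomial.AlgebraMap
import Mathlib.RingTheory.LocalRing.Module
import Mathlib.RingTheory.TensorProduct.Finite
import Mathlib.LinearAlgebra.Dual.Lemmas
import Mathlib.LinearAlgebra.Dimension.FreeAndStrongRankCondition
import Mathlib.LinearAlgebra.TensorProduct.RightExactness
import HarnessLib

/-!
# The Nakayama chart at a prime: cyclicity of `Q_f` from the fibre `Q ⊗ κ(𝔭)`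

Topic `RingTheory/Localization`; namespace `Literature.RingTheory.Localization.CyclicChart` (generic commutative algebra; first consumer:
the M13 see-saw node N1 of cell hodgecm-mathlib — B-p01 (g11) specs (α)/(α′)/(α-br), hand A-p06 (g12) — which instantiates
`A := Γ(W, U)`).  THEOREMS ONLY (Mathlib-only imports); no definition, no named fact, no instance, no `sorry`.

* (α) `exists_away_cyclic` — **Nakayama chart**: if `q` generates the fibre `Q ⊗ κ(𝔭)` of a finite `A`-module `Q` at a prime `𝔭`
  (spelled `Q = A∙q + 𝔭Q`), then some `f ∉ 𝔭` makes `Q` cyclic on `q` after inverting `f`: `∀ x, ∃ n a, fⁿ x = a q`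
  ([AtiyahMacdonald1969, Prop. 2.8 / Cor. 2.7 (Nakayama)]; Mathlib `Submodule.exists_sub_one_mem_and_smul_eq_zero_of_fg_of_le_smul` on
  `Q ⧸ A∙q`, exponent `n = 1`); (α′) `exists_away_cyclic_of_fibre` — the LOCAL form: the hypothesis only at `𝔭`
  (`s • x = a • q + y`, `s ∉ 𝔭`, `y ∈ 𝔭Q`, i.e. `q` generates `Q_𝔭 ⧸ 𝔭Q_𝔭`), same conclusion, by the determinant trick
  ([AtiyahMacdonald1969, Prop. 2.4 / Cor. 2.5]; Mathlib `LinearMap.exists_monic_and_natDegree_eq_and_coeff_mem_pow_and_aeval_eq_zero`).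
* (α-br) the bridges from `Hom_A(Q, κ(𝔭))` (`κ(𝔭) = 𝔭.ResidueField`): `x ↦ φ (1 ⊗ x)` identifies `Hom_A(Q, κ(𝔭))` with the dual of the
  fibre `κ(𝔭) ⊗[A] Q` on pure tensors; `Hom_A(Q, κ(𝔭)) = 0 ⇒ 𝔭 ∉ Supp Q` (`notMem_support_of_forall_linearMap_eq_zero`,
  `smul_mem_of_forall_linearMap_eq_zero`, `exists_away_torsion_of_forall_linearMap_eq_zero`); Hom-cyclicity at `𝔭` ⇒
  `𝔭 ∉ Supp (Q ⧸ A∙q)` for one `q` (`exists_hq_of_homCyclic`, `exists_away_cyclic_of_homCyclic`) — Mathlib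
  `Module.mem_support_iff_nontrivial_residueField_tensorProduct` (Nakayama) and `LocalizedModule.exists_subsingleton_away`.

## References
* [AtiyahMacdonald1969] M. F. Atiyah, I. G. Macdonald, *Introduction to Commutative Algebra* (1969), Prop. 2.4–2.8 p. 21–22, Prop. 2.10
  p. 23, Prop. 2.14 p. 26, Prop. 2.18 p. 28, Ex. 3.19.
-/

set_option autoImplicit false

universe u v

namespace Literature.RingTheory.Localization.CyclicChart

open Submodule

/-! ## (α) The Nakayama chart -/

section Nakayama

variable {A : Type u} [CommRing A] {Q : Type v} [AddCommGroup Q] [Module A Q]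

/-- **Nakayama chart.** If `q` generates `Q ⊗_A κ(𝔭)` — every `x : Q` is `a • q + y` with `y ∈ 𝔭Q` — and `Q` is finite over `A`, then
there is `f ∉ 𝔭` with `∀ x, ∃ n a, f ^ n • x = a • q` (in fact `n = 1`): `Q_f` is cyclic on `q`.
[cite: AtiyahMacdonald1969, Prop. 2.8 and Cor. 2.7 p. 22] -/
theorem exists_away_cyclic [Module.Finite A Q] (𝔭 : Ideal A) [𝔭.IsPrime] (q : Q)
    (hq : ∀ x : Q, ∃ a : A, ∃ y ∈ 𝔭 • (⊤ : Submodule A Q), x = a • q + y) :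
    ∃ f ∉ 𝔭, ∀ x : Q, ∃ (n : ℕ) (a : A), f ^ n • x = a • q := by
  classical
  set N : Submodule A Q := A ∙ q with hN
  -- the quotient `Q ⧸ A∙q` is finite and equals `𝔭 • ⊤`
  have hle : (⊤ : Submodule A (Q ⧸ N)) ≤ 𝔭 • ⊤ := by
    rintro x -
    obtain ⟨x, rfl⟩ := N.mkQ_surjective x
    obtain ⟨a, y, hy, rfl⟩ := hq x
    have hq0 : N.mkQ (a • q) = 0 := by
      rw [Submodule.mkQ_apply, Submodule.Quotient.mk_eq_zero]
      exact Submodule.smul_mem _ a (Submodule.mem_span_singleton_self q)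
    rw [map_add, hq0, zero_add]
    have : N.mkQ y ∈ (𝔭 • (⊤ : Submodule A Q)).map N.mkQ := Submodule.mem_map_of_mem hy
    rwa [Submodule.map_smul'', Submodule.map_top, Submodule.range_mkQ] at this
  have hfg : (⊤ : Submodule A (Q ⧸ N)).FG := by
    rw [← N.range_mkQ, ← Submodule.map_top]
    exact Submodule.FG.map _ Module.Finite.fg_top
  obtain ⟨r, hr1, hr⟩ := Submodule.exists_sub_one_mem_and_smul_eq_zero_of_fg_of_le_smul 𝔭 (⊤ : Submodule A (Q ⧸ N)) hfg hle
  refine ⟨r, fun hr𝔭 => ?_, fun x => ?_⟩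
  · exact Ideal.IsPrime.ne_top ‹_› (Ideal.eq_top_of_isUnit_mem _ (by simpa using 𝔭.sub_mem hr𝔭 hr1) isUnit_one)
  · have hx : N.mkQ (r • x) = 0 := by rw [map_smul]; exact hr _ Submodule.mem_top
    rw [Submodule.mkQ_apply, Submodule.Quotient.mk_eq_zero, hN, Submodule.mem_span_singleton] at hx
    obtain ⟨a, ha⟩ := hx
    exact ⟨1, a, by rw [pow_one, ha]⟩

/-- **Nakayama chart, LOCAL form (α′).** If `q` generates the fibre `Q ⊗_A κ(𝔭)` — every `x : Q` has `s • x = a • q + y` with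
`s ∉ 𝔭`, `y ∈ 𝔭Q` (i.e. `Q_𝔭 = A_𝔭 q + 𝔭 Q_𝔭`) — and `Q` is finite over `A`, then there is `f ∉ 𝔭` with `∀ x, ∃ n a, f ^ n • x = a • q`.
Proof: on `N := Q ⧸ A∙q` one `t ∉ 𝔭` (product of the `s` of a finite generating set) has `t • N ⊆ 𝔭 N`; the Cayley–Hamilton /
determinant trick (Mathlib `LinearMap.exists_monic_and_natDegree_eq_and_coeff_mem_pow_and_aeval_eq_zero`) gives a monic `p` with lower
coefficients in `𝔭` and `p(t) • N = 0`, and `f := p(t) ≡ t^d (mod 𝔭)` is not in `𝔭`.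
[cite: AtiyahMacdonald1969, Prop. 2.4 and Cor. 2.5 p. 21, Prop. 2.8 p. 22] -/
theorem exists_away_cyclic_of_fibre [Module.Finite A Q] (𝔭 : Ideal A) [𝔭.IsPrime] (q : Q)
    (hq : ∀ x : Q, ∃ (a s : A), s ∉ 𝔭 ∧ ∃ y ∈ 𝔭 • (⊤ : Submodule A Q), s • x = a • q + y) :
    ∃ f ∉ 𝔭, ∀ x : Q, ∃ (n : ℕ) (a : A), f ^ n • x = a • q := by
  classical
  set N : Submodule A Q := A ∙ q with hN
  have hNq : ∀ c : A, N.mkQ (c • q) = 0 := fun c => by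
    rw [Submodule.mkQ_apply, Submodule.Quotient.mk_eq_zero]
    exact Submodule.smul_mem _ c (Submodule.mem_span_singleton_self q)
  have hN𝔭 : ∀ y ∈ 𝔭 • (⊤ : Submodule A Q), N.mkQ y ∈ 𝔭 • (⊤ : Submodule A (Q ⧸ N)) := fun y hy => by
    have : N.mkQ y ∈ (𝔭 • (⊤ : Submodule A Q)).map N.mkQ := Submodule.mem_map_of_mem hy
    rwa [Submodule.map_smul'', Submodule.map_top, Submodule.range_mkQ] at this
  -- one `t ∉ 𝔭` for a finite generating set
  obtain ⟨G, hG⟩ : (⊤ : Submodule A Q).FG := Module.Finite.fg_top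
  choose a s hs y hy hxy using hq
  set t : A := ∏ g ∈ G, s g with ht
  have ht𝔭 : t ∉ 𝔭 :=
    Finset.prod_induction _ (fun r => r ∉ 𝔭) (fun b c hb hc hbc => ((‹𝔭.IsPrime›).mem_or_mem hbc).elim hb hc)
      (‹𝔭.IsPrime›).one_notMem (fun g _ => hs g)
  -- `t • N ⊆ 𝔭 N`
  have hrange : LinearMap.range (algebraMap A (Module.End A (Q ⧸ N)) t) ≤ 𝔭 • ⊤ := by
    rintro _ ⟨x, rfl⟩
    rw [Module.algebraMap_end_apply]
    obtain ⟨x, rfl⟩ := N.mkQ_surjective x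
    have hx : x ∈ Submodule.span A (G : Set Q) := by rw [hG]; exact Submodule.mem_top
    induction hx using Submodule.span_induction with
    | mem g hg =>
      obtain ⟨t', ht'⟩ := Finset.dvd_prod_of_mem s hg
      rw [ht, ht', mul_comm (s g) t', mul_smul, ← map_smul, hxy g, map_add, hNq, zero_add]
      exact Submodule.smul_mem _ t' (hN𝔭 _ (hy g))
    | zero => rw [map_zero, smul_zero]; exact Submodule.zero_mem _
    | add x x' _ _ hx hx' => rw [map_add, smul_add]; exact Submodule.add_mem _ hx hx'
    | smul c x _ hx => rw [map_smul, smul_comm t c]; exact Submodule.smul_mem _ c hx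
  -- Cayley–Hamilton
  obtain ⟨p, hmonic, -, hcoeff, haeval⟩ :=
    LinearMap.exists_monic_and_natDegree_eq_and_coeff_mem_pow_and_aeval_eq_zero (R := A) (M := Q ⧸ N)
      (algebraMap A (Module.End A (Q ⧸ N)) t) 𝔭 hrange
  rw [Polynomial.aeval_algebraMap_apply_eq_algebraMap_eval] at haeval
  refine ⟨p.eval t, fun hf𝔭 => ht𝔭 ?_, fun x => ?_⟩
  · -- `p(t) ≡ t ^ d (mod 𝔭)`
    apply (‹𝔭.IsPrime›).mem_of_pow_mem p.natDegree
    have hsum : p.eval t = (∑ i ∈ Finset.range p.natDegree, p.coeff i * t ^ i) + t ^ p.natDegree := by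
      rw [Polynomial.eval_eq_sum_range, Finset.sum_range_succ, hmonic.coeff_natDegree, one_mul]
    have hrest : (∑ i ∈ Finset.range p.natDegree, p.coeff i * t ^ i) ∈ 𝔭 := by
      exact Submodule.sum_mem 𝔭 fun i hi =>
        Ideal.mul_mem_right _ _ (Ideal.pow_le_self (Nat.sub_ne_zero_of_lt (Finset.mem_range.1 hi)) (hcoeff i))
    have := 𝔭.sub_mem hf𝔭 hrest
    rwa [hsum, add_sub_cancel_left] at this
  · have hx : N.mkQ (p.eval t • x) = 0 := by
      have := LinearMap.congr_fun haeval (N.mkQ x)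
      rwa [Module.algebraMap_end_apply, LinearMap.zero_apply, ← map_smul] at this
    rw [Submodule.mkQ_apply, Submodule.Quotient.mk_eq_zero, hN, Submodule.mem_span_singleton] at hx
    obtain ⟨a, ha⟩ := hx
    exact ⟨1, a, by rw [pow_one, ha]⟩

end Nakayama

/-! ## (α-br) From `Hom_A(Q, κ(𝔭))` to the fibre: the bridges and the sockets `brickAlpha0` / `brickAlpha`

`κ(𝔭) = 𝔭.ResidueField`; the fibre `κ(𝔭) ⊗[A] Q` is a finite-dimensional `κ(𝔭)`-space whose dual is `Hom_A(Q, κ(𝔭))`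
(`x ↦ φ (1 ⊗ x)`); Mathlib's `Module.mem_support_iff_nontrivial_residueField_tensorProduct` (Nakayama) and
`LocalizedModule.exists_subsingleton_away` (finite presentation of the support) do the rest. -/

section Fibre

open TensorProduct

variable {A : Type u} [CommRing A] {Q : Type v} [AddCommGroup Q] [Module A Q] (𝔭 : Ideal A) [𝔭.IsPrime]

/-- `k ⊗ x = k • (1 ⊗ x)` in the fibre. [cite: AtiyahMacdonald1969, Prop. 2.14 p. 26] -/
theorem tmul_eq_smul_one_tmul (k : 𝔭.ResidueField) (x : Q) :
    k ⊗ₜ[A] x = k • ((1 : 𝔭.ResidueField) ⊗ₜ[A] x) := by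
  rw [TensorProduct.smul_tmul', smul_eq_mul, mul_one]

/-- a functional on the fibre vanishing on the pure tensors `1 ⊗ x` vanishes. [cite: AtiyahMacdonald1969, Prop. 2.14 p. 26] -/
theorem dual_eq_zero_of_forall_one_tmul (φ : Module.Dual 𝔭.ResidueField (𝔭.ResidueField ⊗[A] Q))
    (h : ∀ x : Q, φ ((1 : 𝔭.ResidueField) ⊗ₜ[A] x) = 0) : φ = 0 := by
  refine LinearMap.ext fun v => ?_
  rw [LinearMap.zero_apply]
  induction v using TensorProduct.induction_on with
  | zero => exact map_zero φ
  | tmul k x => rw [tmul_eq_smul_one_tmul, map_smul, h, smul_zero]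
  | add v w hv hw => rw [map_add, hv, hw, add_zero]

/-- **Hom-cyclicity transfers to the dual of the fibre**: if every `A`-linear `Q → κ(𝔭)` is a multiple of any non-zero one, the
same holds for `κ(𝔭)`-linear functionals on `κ(𝔭) ⊗[A] Q`. [cite: AtiyahMacdonald1969, Prop. 2.10 p. 23] -/
theorem dual_cyclic_of_homCyclic
    (h : ∀ ℓ₁ ℓ₂ : Q →ₗ[A] 𝔭.ResidueField, ℓ₁ ≠ 0 → ∃ c : 𝔭.ResidueField, ℓ₂ = c • ℓ₁)
    (φ₁ φ₂ : Module.Dual 𝔭.ResidueField (𝔭.ResidueField ⊗[A] Q)) (hφ₁ : φ₁ ≠ 0) :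
    ∃ c : 𝔭.ResidueField, φ₂ = c • φ₁ := by
  -- the `A`-linear maps `x ↦ φᵢ (1 ⊗ x)`
  let ℓ : Module.Dual 𝔭.ResidueField (𝔭.ResidueField ⊗[A] Q) → (Q →ₗ[A] 𝔭.ResidueField) := fun φ =>
    (φ.restrictScalars A) ∘ₗ (TensorProduct.mk A 𝔭.ResidueField Q 1)
  have hℓ : ∀ φ x, ℓ φ x = φ ((1 : 𝔭.ResidueField) ⊗ₜ[A] x) := fun _ _ => rfl
  have h₁ : ℓ φ₁ ≠ 0 := fun h0 =>
    hφ₁ (dual_eq_zero_of_forall_one_tmul 𝔭 φ₁ fun x => by rw [← hℓ, h0, LinearMap.zero_apply])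
  obtain ⟨c, hc⟩ := h _ (ℓ φ₂) h₁
  refine ⟨c, ?_⟩
  rw [← sub_eq_zero]
  refine dual_eq_zero_of_forall_one_tmul 𝔭 _ fun x => ?_
  rw [LinearMap.sub_apply, LinearMap.smul_apply, ← hℓ, ← hℓ, hc, LinearMap.smul_apply, sub_self]

/-- **`Hom_A(Q, κ(𝔭)) = 0 ⇒ κ(𝔭) ⊗[A] Q = 0`** (the fibre is a vector space separated by its dual).
[cite: AtiyahMacdonald1969, Prop. 2.8 p. 22 and Ex. 2.3] -/
theorem subsingleton_fibre_of_forall_linearMap_eq_zero (h0 : ∀ ℓ : Q →ₗ[A] 𝔭.ResidueField, ℓ = 0) :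
    Subsingleton (𝔭.ResidueField ⊗[A] Q) := by
  refine subsingleton_of_forall_eq 0 fun v => (Module.forall_dual_apply_eq_zero_iff 𝔭.ResidueField v).1 fun φ => ?_
  rw [dual_eq_zero_of_forall_one_tmul 𝔭 φ fun x => ?_, LinearMap.zero_apply]
  have := LinearMap.congr_fun (h0 ((φ.restrictScalars A) ∘ₗ (TensorProduct.mk A 𝔭.ResidueField Q 1))) x
  rwa [LinearMap.zero_apply] at this

/-- **Hom-cyclicity ⇒ the fibre is spanned by ONE pure tensor `1 ⊗ q`** (every element is `c ⊗ q`).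
[cite: AtiyahMacdonald1969, Prop. 2.8 p. 22] -/
theorem exists_forall_eq_tmul_of_homCyclic [Module.Finite A Q]
    (h : ∀ ℓ₁ ℓ₂ : Q →ₗ[A] 𝔭.ResidueField, ℓ₁ ≠ 0 → ∃ c : 𝔭.ResidueField, ℓ₂ = c • ℓ₁) :
    ∃ q : Q, ∀ v : 𝔭.ResidueField ⊗[A] Q, ∃ c : 𝔭.ResidueField, v = c ⊗ₜ[A] q := by
  classical
  set K := 𝔭.ResidueField
  by_cases hV : ∀ x : Q, (1 : K) ⊗ₜ[A] x = (0 : K ⊗[A] Q)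
  · -- the fibre vanishes: `q := 0`
    refine ⟨0, fun v => ⟨0, ?_⟩⟩
    rw [zero_tmul]
    induction v using TensorProduct.induction_on with
    | zero => rfl
    | tmul k x => rw [tmul_eq_smul_one_tmul, hV x, smul_zero]
    | add v w hv hw => rw [hv, hw, add_zero]
  · push Not at hV
    obtain ⟨x₀, hx₀⟩ := hV
    -- a functional not vanishing at `1 ⊗ x₀`, hence `dim (fibre)^* ≤ 1`, hence `dim fibre ≤ 1`
    obtain ⟨φ₁, hφ₁⟩ : ∃ φ₁ : Module.Dual K (K ⊗[A] Q), φ₁ ((1 : K) ⊗ₜ[A] x₀) ≠ 0 := by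
      by_contra hno
      push Not at hno
      exact hx₀ ((Module.forall_dual_apply_eq_zero_iff K _).1 hno)
    have hφ₁0 : φ₁ ≠ 0 := fun h0 => hφ₁ (by rw [h0, LinearMap.zero_apply])
    have hdual : Module.finrank K (Module.Dual K (K ⊗[A] Q)) ≤ 1 :=
      finrank_le_one_iff.2 ⟨φ₁, fun φ₂ => (dual_cyclic_of_homCyclic 𝔭 h φ₁ φ₂ hφ₁0).imp fun c hc => hc.symm⟩
    rw [Subspace.dual_finrank_eq] at hdual
    obtain ⟨v₁, hv₁⟩ := finrank_le_one_iff.1 hdual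
    obtain ⟨c₀, hc₀⟩ := hv₁ ((1 : K) ⊗ₜ[A] x₀)
    have hc₀0 : c₀ ≠ 0 := by
      rintro rfl
      exact hx₀ (by rw [← hc₀, zero_smul])
    refine ⟨x₀, fun w => ?_⟩
    obtain ⟨c, rfl⟩ := hv₁ w
    refine ⟨c * c₀⁻¹, ?_⟩
    rw [tmul_eq_smul_one_tmul 𝔭 (c * c₀⁻¹) x₀, ← hc₀, smul_smul, mul_assoc, inv_mul_cancel₀ hc₀0, mul_one]

/-- if the fibre is spanned by `1 ⊗ q`, the fibre of `Q ⧸ A∙q` vanishes (right exactness of `κ(𝔭) ⊗ –`, surjectivity half only).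
[cite: AtiyahMacdonald1969, Prop. 2.18 p. 28] -/
theorem subsingleton_fibre_quotient_span_singleton (q : Q)
    (hq : ∀ v : 𝔭.ResidueField ⊗[A] Q, ∃ c : 𝔭.ResidueField, v = c ⊗ₜ[A] q) :
    Subsingleton (𝔭.ResidueField ⊗[A] (Q ⧸ (A ∙ q))) := by
  refine subsingleton_of_forall_eq 0 fun w => ?_
  obtain ⟨v, rfl⟩ := LinearMap.lTensor_surjective 𝔭.ResidueField (A ∙ q).mkQ_surjective w
  obtain ⟨c, rfl⟩ := hq v
  rw [LinearMap.lTensor_tmul, Submodule.mkQ_apply, (Submodule.Quotient.mk_eq_zero _).2 (Submodule.mem_span_singleton_self q),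
    tmul_zero]

/-- **Hom-cyclicity ⇒ `𝔭 ∉ Supp (Q ⧸ A∙q)` for a suitable `q`** (Nakayama, Mathlib
`Module.mem_support_iff_nontrivial_residueField_tensorProduct`). [cite: AtiyahMacdonald1969, Prop. 2.8 p. 22, Ex. 3.19] -/
theorem exists_notMem_support_quotient_of_homCyclic [Module.Finite A Q]
    (h : ∀ ℓ₁ ℓ₂ : Q →ₗ[A] 𝔭.ResidueField, ℓ₁ ≠ 0 → ∃ c : 𝔭.ResidueField, ℓ₂ = c • ℓ₁) :
    ∃ q : Q, (⟨𝔭, inferInstance⟩ : PrimeSpectrum A) ∉ Module.support A (Q ⧸ (A ∙ q)) := by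
  obtain ⟨q, hq⟩ := exists_forall_eq_tmul_of_homCyclic 𝔭 h
  refine ⟨q, fun hmem => ?_⟩
  have hnt := (Module.mem_support_iff_nontrivial_residueField_tensorProduct (R := A) (M := Q ⧸ (A ∙ q)) _).1 hmem
  have hss := subsingleton_fibre_quotient_span_singleton 𝔭 q hq
  exact false_of_nontrivial_of_subsingleton (𝔭.ResidueField ⊗[A] (Q ⧸ (A ∙ q)))

/-- **`Hom_A(Q, κ(𝔭)) = 0 ⇒ 𝔭 ∉ Supp Q`**. [cite: AtiyahMacdonald1969, Prop. 2.8 p. 22, Ex. 3.19] -/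
theorem notMem_support_of_forall_linearMap_eq_zero [Module.Finite A Q] (h0 : ∀ ℓ : Q →ₗ[A] 𝔭.ResidueField, ℓ = 0) :
    (⟨𝔭, inferInstance⟩ : PrimeSpectrum A) ∉ Module.support A Q := fun hmem => by
  have hnt := (Module.mem_support_iff_nontrivial_residueField_tensorProduct (R := A) (M := Q) _).1 hmem
  have hss := subsingleton_fibre_of_forall_linearMap_eq_zero 𝔭 h0
  exact false_of_nontrivial_of_subsingleton (𝔭.ResidueField ⊗[A] Q)

/-- **(α-br1), strong form**: `Hom_A(Q, κ(𝔭)) = 0 ⇒` every `x` is killed by some `s ∉ 𝔭`.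
[cite: AtiyahMacdonald1969, Prop. 2.8 p. 22, Ex. 3.19] -/
theorem exists_smul_eq_zero_of_forall_linearMap_eq_zero [Module.Finite A Q] (h0 : ∀ ℓ : Q →ₗ[A] 𝔭.ResidueField, ℓ = 0)
    (x : Q) : ∃ s ∉ 𝔭, s • x = 0 :=
  Module.notMem_support_iff'.1 (notMem_support_of_forall_linearMap_eq_zero 𝔭 h0) x

/-- **(α-br1)** as B-p01 consumes it: `Hom_A(Q, κ(𝔭)) = 0 ⇒ ∀ x, ∃ s ∉ 𝔭, s • x ∈ 𝔭Q` (indeed `s • x = 0`).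
[cite: AtiyahMacdonald1969, Prop. 2.8 p. 22] -/
theorem smul_mem_of_forall_linearMap_eq_zero [Module.Finite A Q] (h0 : ∀ ℓ : Q →ₗ[A] 𝔭.ResidueField, ℓ = 0) (x : Q) :
    ∃ s ∉ 𝔭, s • x ∈ 𝔭 • (⊤ : Submodule A Q) := by
  obtain ⟨s, hs, h⟩ := exists_smul_eq_zero_of_forall_linearMap_eq_zero 𝔭 h0 x
  exact ⟨s, hs, by rw [h]; exact Submodule.zero_mem _⟩

/-- **(α-br2)**: Hom-cyclicity at `𝔭` ⇒ the localised fibre hypothesis `hq` of `exists_away_cyclic_of_fibre` (indeed with `y = 0`).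
[cite: AtiyahMacdonald1969, Prop. 2.8 p. 22] -/
theorem exists_hq_of_homCyclic [Module.Finite A Q]
    (h : ∀ ℓ₁ ℓ₂ : Q →ₗ[A] 𝔭.ResidueField, ℓ₁ ≠ 0 → ∃ c : 𝔭.ResidueField, ℓ₂ = c • ℓ₁) :
    ∃ q : Q, ∀ x : Q, ∃ (a s : A), s ∉ 𝔭 ∧ ∃ y ∈ 𝔭 • (⊤ : Submodule A Q), s • x = a • q + y := by
  obtain ⟨q, hq⟩ := exists_notMem_support_quotient_of_homCyclic 𝔭 h
  refine ⟨q, fun x => ?_⟩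
  obtain ⟨s, hs, h0⟩ := Module.notMem_support_iff'.1 hq ((A ∙ q).mkQ x)
  rw [← map_smul, Submodule.mkQ_apply, Submodule.Quotient.mk_eq_zero, Submodule.mem_span_singleton] at h0
  obtain ⟨a, ha⟩ := h0
  exact ⟨a, s, hs, 0, Submodule.zero_mem _, by rw [add_zero, ha]⟩

/-- **socket `brickAlpha0`**: `Hom_A(Q, κ(𝔭)) = 0 ⇒ Q_f = 0` for some `f ∉ 𝔭` (every `x` killed by a power of `f`).
[cite: AtiyahMacdonald1969, Prop. 2.8 p. 22, Ex. 3.19 (v)] -/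
theorem exists_away_torsion_of_forall_linearMap_eq_zero [Module.Finite A Q]
    (h0 : ∀ ℓ : Q →ₗ[A] 𝔭.ResidueField, ℓ = 0) : ∃ f ∉ 𝔭, ∀ x : Q, ∃ n : ℕ, f ^ n • x = 0 := by
  haveI : Subsingleton (LocalizedModule 𝔭.primeCompl Q) :=
    Module.notMem_support_iff.1 (notMem_support_of_forall_linearMap_eq_zero 𝔭 h0)
  obtain ⟨f, hf, hsub⟩ := LocalizedModule.exists_subsingleton_away (M := Q) 𝔭
  refine ⟨f, hf, fun x => ?_⟩
  obtain ⟨r, ⟨n, rfl⟩, hr⟩ := (LocalizedModule.subsingleton_iff.1 hsub) x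
  exact ⟨n, hr⟩

/-- **socket `brickAlpha`**: Hom-cyclicity at `𝔭` ⇒ for some `f ∉ 𝔭` and `q`, `Q_f` is cyclic on `q`.
[cite: AtiyahMacdonald1969, Prop. 2.8 p. 22, Ex. 3.19 (v)] -/
theorem exists_away_cyclic_of_homCyclic [Module.Finite A Q]
    (h : ∀ ℓ₁ ℓ₂ : Q →ₗ[A] 𝔭.ResidueField, ℓ₁ ≠ 0 → ∃ c : 𝔭.ResidueField, ℓ₂ = c • ℓ₁) :
    ∃ f ∉ 𝔭, ∃ q : Q, ∀ x : Q, ∃ (n : ℕ) (a : A), f ^ n • x = a • q := by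
  obtain ⟨q, hq⟩ := exists_notMem_support_quotient_of_homCyclic 𝔭 h
  haveI : Subsingleton (LocalizedModule 𝔭.primeCompl (Q ⧸ (A ∙ q))) := Module.notMem_support_iff.1 hq
  obtain ⟨f, hf, hsub⟩ := LocalizedModule.exists_subsingleton_away (M := Q ⧸ (A ∙ q)) 𝔭
  refine ⟨f, hf, q, fun x => ?_⟩
  obtain ⟨r, ⟨n, rfl⟩, hr⟩ := (LocalizedModule.subsingleton_iff.1 hsub) ((A ∙ q).mkQ x)
  rw [← map_smul, Submodule.mkQ_apply, Submodule.Quotient.mk_eq_zero, Submodule.mem_span_singleton] at hr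
  obtain ⟨a, ha⟩ := hr
  exact ⟨n, a, ha.symm⟩

end Fibre

end Literature.RingTheory.Localization.CyclicChart
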